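import Summits.ResolutionOfSingularities.ResolutionOfSingularities.Theorems.DepthCutCells
import Summits.ResolutionOfSingularities.ResolutionOfSingularities.Theorems.SatelliteAlgebra
import HarnessLib

/-!
# SatelliteTransport — decomp-res node «SatelliteCut» (lens-4 g28, critic row 164), tree file 2/5 of the node

Content VERBATIM from the decomp-res lens-4 g28 node `HOME/decomp-res-lens-4/g28/SatelliteCut.lean` (pin b83bf2f8 =
`parts/SatelliteCut-g28-b83bf2f8.lean`,
998 l; HOME = run/shared/lean/pub/decomp-res): ONE NEW PART §74–§77 = `parts/part_new-g28-3bc4b3a5.lean` (46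
declarations), typed against the LANDED
tree (the node imports `Theorems/DepthCutCells` + `Theorems/MaxContactCutCompanionCut` only; nothing carried, nothing inlined).
Critic: CRITIC-LEDGER row 164 (2026-08-31T01:23:24Z): CLEARED — DECIDED +1 · MAP 0 (the SATELLITE NO-JUMP LAW over
two consecutive blow-ups =
Hauser's kangaroo condition (3) in kernel, unconditional in the shallow prime-weight window; typed sub-cell `n.Prime
∧ SatelliteJumpTower n` of
`NoWildShallowCompanionKangarooTowers` EMPTY for every `n`; EXACT hypothesis-free re-location to
`NoWildFreeJumpShallowCompanionKangarooTowers`; entrances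
on both sides; census cross-check T-satellite (census-1 g23, `HOME/census/it/kangsat/T-satellite.md` 2d03875b)
confirmed 2/2 · 33/33 · 0/88).
Landing orders INBOX :651 (lens-4 g28 landing note, split per NEXT-g29 §3) and :659 (critic): `--kind proof
--supports stmt-ResolutionOfSingularities-28338`,
namespace `…Theorems.HugValuationCut`, canonical headers, one file per section (D-0064); files of the node:
`SatelliteAlgebra` (§74) · `SatelliteTransport` + `SatelliteTransport2` (§75) ·
`SatelliteCutCells` (§76–§77, cone-free cells: the aside home) · `MaxContactCutSatelliteCut` (the four §77
corollaries GIVEN 31571 `MaxContactCut.NoContactHuggingTowers`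
BY NAME — in the Theses cone, kept apart so that the route file can import the aside home without an import cycle,
as for `DepthCutCells` / `MaxContactCutDepthCut`).
Aside bookkeeping (row 164 / INBOX :659): ONE successor aside on the lens-4 column,
`NoWildFreeJumpShallowCompanionKangarooTowers` (home `SatelliteCutCells`),
SUPERSEDING g27's `NoWildShallowCompanionKangarooTowers` (exact hyp-free
`noWildShallowCompanionKangarooTowers_iff_g28`); the decided cell
`NoWildSatelliteJumpShallowTowers` is a THEOREM (`noWildSatelliteJumpShallowTowers_holds`) and is not filed.  TWO
TEXT FIXES at landing (docstrings only, ordered by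
the critic, row 164 / INBOX :659; no statement or proof changed): (i) the hand inhabitant in the docstring of
`WildFreeJumpShallowCompanionKangarooTowersTerminate`
is NODE-g28's isolated chain `Z² + U³ + U²T + T⁵ → z² + u²t + u³t + t³ → (z₁ + t)² + tv² + vt² + v²t² + v³t²` (the
lens text named a non-isolated polynomial);
(ii) the part's declaration count «42» → 46.

## This file

§75 (NEW, KERNEL) TWO CONSECUTIVE POINT BLOW-UPS — `section SatelliteTransport`: the principal weak-contact
predicate `PWInv I H n y` (the tree's `WInv` + principality `𝓘_y ≤ (f) + 𝔪^{2n}`), the MEMORY predicate `ETail I H E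
n y` (`H_y = (z)`, `E_y = (t)`, `IsRsopPart ![t, z]`, `f − c·z^n ∈ (t) ∩ 𝔪^{n+1}`) with its forgetful maps
`wInv_of_eTail` / `wInv_of_pwInv`, `stalk_strictTransform_eq_span`, `quotient_mem_stalk_strictTransform`,
`point_round_chart_rsop` (the tree's `point_round_chart` + the conjunct `IsRsopPart ![π^*𝔷, z′]` via
`isRsopPart_chartFamily_reesChart`; keeps its `set_option maxHeartbeats 400000 in`) — the two transport theorems
S1/S2 follow in `SatelliteTransport2`.  Imports `DepthCutCells` (the forced-tower / weak-contact API of the lens-4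
column) + `SatelliteAlgebra`.

[WRITER NOTE (decomp-res writer g10): file split only (tree files ≤ 400 lines); namespace, universes, sections,
section variables and every declaration
exactly as in the lens (the node's global `set_option` and the `open …Theses` line live only in the wiring file; the
pure-algebra file opens only what it uses).]

(Sources: Hauser2010Kangaroo (arXiv:0811.4151 p. 6, Kangaroo Theorem condition (3) + remark (a)); HauserPerlega2019
§2; Hauser2024 PRIMS 60; Moh1987; Matsumura1987 Thms. 14.2–14.3; ZariskiSamuel1960 VIII §11; StacksProject Tag 00NQ;
CossartPiltant2008 §2; Giraud1975.)
-/

noncomputable section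

open CategoryTheory AlgebraicGeometry IsLocalRing
open Literature.AlgebraicGeometry.Resolution
open Summit.ResolutionOfSingularities.ResolutionOfSingularities.Theorems
open WeakOrderReduction ForcedTowerClasses DivergentTowerClasses MonomialTowerClasses
open HugDimensionClasses HugDimensionKernels SurfaceShadowClasses SurfaceShadowKernels
open NearPointCut (SingularClass)
open AbsoluteContactClasses (IsAbsContactAt SepResidueAt diffIdeal_restrict_le stalkMap_comp_toStalk_eq_stalkHom)
open scoped BigOperators

namespace Summit.ResolutionOfSingularities.ResolutionOfSingularities.Theorems.HugValuationCut

section SatelliteTransport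

universe uT
variable {X X' : Scheme.{uT}} {π : X' ⟶ X} {C : X.IdealSheafData}

/-! ## §75 (g28 · NEW · KERNEL) TWO CONSECUTIVE POINT BLOW-UPS: the principal weak-contact presentation is transported with
its EXCEPTIONAL FACTOR, and at a SATELLITE point of the second blow-up (a point of the strict transform of the first exceptional
divisor) the transported tail is divisible by the product `s·t₁` of TWO regular parameters — which a `p`-power initial form
forbids: NO KANGAROO (translational) JUMP AT A SATELLITE POINT. -/

/-- **`PWInv 𝓘 H n y` — PRINCIPAL weak contact along the germ `H`** (NEW TYPED PREDICATE): `H_y = (z)`, `z ∈ 𝔪_y ∖ 𝔪_y²`, and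
some `f ∈ 𝓘_y` with `𝓘_y ⊆ (f) + 𝔪_y^{2n}` (the marked stalk is principal modulo `𝔪^{2n}`, as in `DeepPointAt`) has
`f − c·z^n ∈ 𝔪_y^{n+1}`, `c` a unit.  DEFINITION (support). -/
def PWInv {Y : Scheme.{uT}} (I H : Y.IdealSheafData) (n : ℕ) (y : Y) : Prop :=
  ∃ z : Y.presheaf.stalk y, stalkIdeal H y = Ideal.span {z} ∧ z ∈ maximalIdeal (Y.presheaf.stalk y) ∧
    z ∉ maximalIdeal (Y.presheaf.stalk y) ^ 2 ∧
    ∃ f ∈ stalkIdeal I y, stalkIdeal I y ≤ Ideal.span {f} ⊔ maximalIdeal (Y.presheaf.stalk y) ^ (2 * n) ∧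
      ∃ c : Y.presheaf.stalk y, IsUnit c ∧ f - c * z ^ n ∈ maximalIdeal (Y.presheaf.stalk y) ^ (n + 1)

/-- **`ETail 𝓘 H E n y` — weak contact along `H` WITH AN `E`-DIVISIBLE TAIL** (NEW TYPED PREDICATE, the two-blow-up memory):
`H_y = (z)`, `E_y = (t)` with `(t, z)` PART OF ONE REGULAR SYSTEM OF PARAMETERS of `𝒪_y`, and some `f ∈ 𝓘_y`, `c` a unit,
with `f − c·z^n ∈ (t) ∩ 𝔪_y^{n+1}`: in Hauser's letters `f = z^n + t·g`, `ord(t·g) ≥ n + 1` — the exceptional monomial of the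
LAST blow-up is remembered.  DEFINITION (support). -/
def ETail {Y : Scheme.{uT}} (I H E : Y.IdealSheafData) (n : ℕ) (y : Y) : Prop :=
  ∃ z t : Y.presheaf.stalk y, stalkIdeal H y = Ideal.span {z} ∧ stalkIdeal E y = Ideal.span {t} ∧
    IsRsopPart ![t, z] ∧
    ∃ f ∈ stalkIdeal I y, ∃ c : Y.presheaf.stalk y, IsUnit c ∧
      f - c * z ^ n ∈ Ideal.span {t} ∧ f - c * z ^ n ∈ maximalIdeal (Y.presheaf.stalk y) ^ (n + 1)

/-- `ETail` forgets to the weak-contact invariant `WInv`. [folklore] -/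
theorem wInv_of_eTail {Y : Scheme.{uT}} {I H E : Y.IdealSheafData} {n : ℕ} {y : Y} (h : ETail I H E n y) :
    WInv I H n y := by
  obtain ⟨z, t, hHz, -, hrs, f, hfI, c, hc, -, hfz⟩ := h
  have hz1 : z ∈ maximalIdeal _ := by simpa using hrs.mem_maximalIdeal 1
  have hz2 : z ∉ maximalIdeal _ ^ 2 := by simpa using hrs.not_mem_sq 1
  exact ⟨z, hHz, hz1, hz2, f, hfI, c, hc, hfz⟩

/-- `PWInv` forgets to `WInv`. [folklore] -/
theorem wInv_of_pwInv {Y : Scheme.{uT}} {I H : Y.IdealSheafData} {n : ℕ} {y : Y} (h : PWInv I H n y) : WInv I H n y := by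
  obtain ⟨z, hHz, hz1, hz2, f, hfI, -, c, hc, hfz⟩ := h
  exact ⟨z, hHz, hz1, hz2, f, hfI, c, hc, hfz⟩

/-- **The strict transform of a regular hypersurface germ through the next point** (the computation inside the tree's
`wInv_point_transport`, isolated): `H_x = (z)`, `π^*z = t·z'`, `E_y = (t)`, `(z')` prime, `t ∉ (z')` ⟹ `H'_y = (z')`.
(Sources: StacksProject, Tag 0BIQ.) -/
theorem stalk_strictTransform_eq_span [IsLocallyNoetherian X'] (H : X.IdealSheafData) (y : X')
    {z : X.presheaf.stalk (π y)} {t z' : X'.presheaf.stalk y}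
    (hHz : stalkIdeal H (π y) = Ideal.span {z}) (hE : stalkIdeal (C.comap π) y = Ideal.span {t})
    (hzz' : (π.stalkMap y).hom z = t * z') (hprime : (Ideal.span {z'}).IsPrime) (htz' : t ∉ Ideal.span {z'}) :
    stalkIdeal (strictTransformIdeal π C H) y = Ideal.span {z'} := by
  rw [stalkIdeal_strictTransformIdeal π C H y, hHz, Ideal.map_span, Set.image_singleton, hzz', hE]
  apply le_antisymm
  · refine iSup_le fun m => fun a ha => ?_
    have h1 : a * t ^ m ∈ Ideal.span {z'} := by
      have h2 : a * t ^ m ∈ Ideal.span {t * z'} :=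
        Submodule.mem_colon.mp ha (t ^ m) (Ideal.pow_mem_pow (Ideal.mem_span_singleton_self _) m)
      exact Ideal.span_singleton_le_iff_mem _ |>.mpr
        (Ideal.mul_mem_left _ t (Ideal.mem_span_singleton_self z')) h2
    rcases hprime.mem_or_mem h1 with h3 | h3
    · exact h3
    · exact absurd (hprime.mem_of_pow_mem m h3) htz'
  · refine le_iSup_of_le 1 fun a ha => ?_
    obtain ⟨c₁, rfl⟩ := Ideal.mem_span_singleton'.mp ha
    refine Submodule.mem_colon.mpr fun s hs => ?_
    rw [pow_one] at hs
    obtain ⟨b₁, rfl⟩ := Ideal.mem_span_singleton'.mp hs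
    rw [smul_eq_mul, show c₁ * z' * (b₁ * t) = (c₁ * b₁) * (t * z') by ring]
    exact Ideal.mul_mem_left _ _ (Ideal.mem_span_singleton_self _)

/-- the proper-transform quotient lies in the strict transform: `π^*z = t·z'` ⟹ `z' ∈ H'_y`. [folklore] -/
theorem quotient_mem_stalk_strictTransform [IsLocallyNoetherian X'] (H : X.IdealSheafData) (y : X')
    {z : X.presheaf.stalk (π y)} {t z' : X'.presheaf.stalk y} (hzH : z ∈ stalkIdeal H (π y))
    (hE : stalkIdeal (C.comap π) y = Ideal.span {t}) (hzz' : (π.stalkMap y).hom z = t * z') :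
    z' ∈ stalkIdeal (strictTransformIdeal π C H) y := by
  rw [stalkIdeal_strictTransformIdeal π C H y, hE]
  refine Ideal.mem_iSup_of_mem 1 (Submodule.mem_colon.mpr fun s hs => ?_)
  rw [pow_one] at hs
  obtain ⟨b₁, rfl⟩ := Ideal.mem_span_singleton'.mp hs
  rw [smul_eq_mul, show z' * (b₁ * t) = b₁ * (t * z') by ring, ← hzz']
  exact Ideal.mul_mem_left _ _ (Ideal.mem_map_of_mem _ hzH)

set_option maxHeartbeats 400000 in

/-- **Point round, chart side, WITH THE JOINT PARAMETER LETTER** (the tree's `AbsoluteContactClasses.point_round_chart` plus one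
conjunct): if `z' ∈ 𝔪_y` then `(t, z')` IS PART OF ONE REGULAR SYSTEM OF PARAMETERS of `𝒪_{X',y}` — both are members of the
regular system `(c_i, c_j/c_i, …)` of the local ring of the blow-up chart (`isRsopPart_chartFamily_reesChart`).
(Sources: StacksProject, Tag 0BIQ; Matsumura1987, Thm. 14.2; DeJong1996, 2.4.) -/
theorem point_round_chart_rsop (hπ : IsBlowup π C) (y : X') [IsRegularLocalRing (X.presheaf.stalk (π y))]
    (hC : stalkIdeal C (π y) = maximalIdeal (X.presheaf.stalk (π y)))
    {z : X.presheaf.stalk (π y)} (hz1 : z ∈ maximalIdeal _) (hz2 : z ∉ maximalIdeal _ ^ 2)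
    {H : X.IdealSheafData} (hH : stalkIdeal H (π y) = Ideal.span {z}) :
    ∃ (𝔷 : X.presheaf.stalk (π y)) (z' : X'.presheaf.stalk y),
      stalkIdeal (C.comap π) y = Ideal.span {(π.stalkMap y).hom 𝔷} ∧
      (π.stalkMap y).hom 𝔷 ∈ nonZeroDivisors (X'.presheaf.stalk y) ∧
      (π.stalkMap y).hom z = (π.stalkMap y).hom 𝔷 * z' ∧
      stalkIdeal (controlledTransform π C H 1) y = Ideal.span {z'} ∧
      (z' ∈ maximalIdeal (X'.presheaf.stalk y) →
        z' ∉ maximalIdeal (X'.presheaf.stalk y) ^ 2 ∧ (Ideal.span {z'}).IsPrime ∧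
          (π.stalkMap y).hom 𝔷 ∉ Ideal.span {z'} ∧ IsRsopPart ![(π.stalkMap y).hom 𝔷, z']) := by
  classical
  have hrs : IsRsopPart (fun _ : Fin 1 => z) := AbsoluteContactClasses.isRsopPart_one_of_not_mem_sq hz1 hz2
  obtain ⟨e, c, hd, hc, hc0⟩ := hrs.exists_rsop
  set j0 : Fin (1 + e) := Fin.castAdd e 0 with hj0def
  have hcj0 : c j0 = z := hc0 0
  have hcC : Ideal.span (Set.range c) = stalkIdeal C (π y) := hc.trans hC.symm
  have hTH : Ideal.span (c '' {j0}) = stalkIdeal H (π y) := by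
    rw [Set.image_singleton, hcj0, hH]
  obtain ⟨i, 𝔴, χ, hχ, hloc, h𝔴⟩ := hπ.exists_reesChart_stalk y c hcC
  obtain ⟨hE, hH'⟩ := hπ.stalkIdeal_controlledTransform_eq_span_chartGen y c hcC {j0} hTH i 𝔴 χ hχ hloc
  letI alg : Algebra (chartRing c i) (X'.presheaf.stalk y) := χ.toAlgebra
  haveI : IsLocalization.AtPrime (X'.presheaf.stalk y) 𝔴.asIdeal := hloc
  have halg : ∀ b, algebraMap (chartRing c i) (X'.presheaf.stalk y) b = χ b := fun b => by
    rw [RingHom.algebraMap_toAlgebra]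
  refine ⟨c i, χ (chartGen c i j0), ?_, ?_, ?_, ?_, ?_⟩
  · rw [hE, hχ]
  · rw [← hχ, ← halg]
    exact IsLocalization.nonZeroDivisors_le_comap 𝔴.asIdeal.primeCompl _
      (reesChartBase_mem_nonZeroDivisors _ _)
  · rw [← hcj0, ← hχ, ← hχ, reesChartBase_apply_eq_mul_chartGen c i j0, map_mul]
  · rw [hH', Set.image_singleton]
  · intro hz'm
    have hmem𝔴 : chartGen c i j0 ∈ 𝔴.asIdeal := by
      have h2 : χ (chartGen c i j0) ∈ maximalIdeal (X'.presheaf.stalk y) := hz'm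
      rw [← halg] at h2
      exact (IsLocalization.AtPrime.to_map_mem_maximal_iff (X'.presheaf.stalk y) 𝔴.asIdeal _).mp h2
    have hj0i : j0 ≠ i := by
      intro h
      have h1 : chartGen c i j0 = 1 := by rw [h]; exact chartGen_self c i
      rw [h1] at hmem𝔴
      exact 𝔴.isPrime.ne_top ((Ideal.eq_top_iff_one _).mpr hmem𝔴)
    -- empty complementary family
    let w : Fin 0 → X.presheaf.stalk (π y) := fun k => k.elim0
    have hrange : Set.range (Fin.append c w) = Set.range c := by
      ext a
      constructor
      · rintro ⟨m, rfl⟩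
        refine Fin.addCases (fun j => ?_) (fun k => k.elim0) m
        exact ⟨j, by rw [Fin.append_left]⟩
      · rintro ⟨j, rfl⟩
        exact ⟨Fin.castAdd 0 j, by rw [Fin.append_left]⟩
    have hzw : Ideal.span (Set.range (Fin.append c w)) = maximalIdeal _ := by rw [hrange, hc]
    have hd' : (maximalIdeal (X.presheaf.stalk (π y))).spanFinrank = (1 + e) + 0 := by
      rw [hd, Nat.add_zero]
    let jJ : Fin 1 → {j : Fin (1 + e) // j ≠ i} := fun _ => ⟨j0, hj0i⟩
    have hjJ : Function.Injective jJ := Function.injective_of_subsingleton _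
    haveI : 𝔴.asIdeal.IsPrime := 𝔴.isPrime
    have hR := isRsopPart_chartFamily_reesChart c i w hzw hd' 𝔴.asIdeal h𝔴 (X'.presheaf.stalk y) jJ hjJ
      (fun _ => hmem𝔴)
    have hy : y ∈ (controlledTransform π C H 1).support := by
      rw [mem_support_iff_stalkIdeal_le, hH', Set.image_singleton, Ideal.span_le, Set.singleton_subset_iff]
      exact hz'm
    have key := hπ.isPrime_stalkIdeal_controlledTransform_of_rsop y c w hzw hd' hcC {j0} hTH hy
    have hH'' : stalkIdeal (controlledTransform π C H 1) y = Ideal.span {χ (chartGen c i j0)} := by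
      rw [hH', Set.image_singleton]
    have h0 : chartFamily c i w (X'.presheaf.stalk y) (chartBase c i) (chartGen c i) jJ 0 = (π.stalkMap y).hom (c i) := by
      rw [← hχ (c i), ← halg]
      simp only [chartFamily, Fin.cons_zero]
    have h5 : chartFamily c i w (X'.presheaf.stalk y) (chartBase c i) (chartGen c i) jJ (Fin.succ (Fin.castAdd 0 0)) =
        χ (chartGen c i j0) := by
      rw [← halg]
      simp only [chartFamily, Fin.cons_succ, Fin.append_left, jJ]
    refine ⟨?_, ?_, fun h => key.2 ?_, ?_⟩
    · have h6 := hR.not_mem_sq (Fin.succ (Fin.castAdd 0 0))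
      rw [h5] at h6
      exact h6
    · rw [← hH'']
      exact key.1
    · have hE1 : stalkIdeal (C.comap π) y = Ideal.span {(π.stalkMap y).hom (c i)} := by rw [hE, hχ]
      rw [hE1, hH'']
      exact (Ideal.span_singleton_le_iff_mem _).mpr h
    · refine isRsopPart_of_range_eq hR rfl ?_
      have hv0 : (![(π.stalkMap y).hom (c i), χ (chartGen c i j0)] : Fin 2 → X'.presheaf.stalk y) 0 =
          (π.stalkMap y).hom (c i) := rfl
      have hv1 : (![(π.stalkMap y).hom (c i), χ (chartGen c i j0)] : Fin 2 → X'.presheaf.stalk y) 1 =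
          χ (chartGen c i j0) := rfl
      apply Set.Subset.antisymm
      · rintro _ ⟨a, rfl⟩
        refine Fin.cases ?_ (fun a' => ?_) a
        · exact ⟨0, h0.trans hv0.symm⟩
        · have ha' : a' = 0 := Subsingleton.elim _ _
          subst ha'
          exact ⟨Fin.succ (Fin.castAdd 0 0), h5.trans hv1.symm⟩
      · rintro _ ⟨a, rfl⟩
        refine Fin.cases ?_ (fun a' => ?_) a
        · exact ⟨0, hv0.trans h0.symm⟩
        · have ha' : a' = Fin.castAdd 0 0 := by
            apply Fin.ext
            have h1 := a'.2
            simp only [Fin.val_castAdd, Fin.val_zero]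
            omega
          subst ha'
          exact ⟨1, hv1.trans h5.symm⟩

end SatelliteTransport

end Summit.ResolutionOfSingularities.ResolutionOfSingularities.Theorems.HugValuationCut
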